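import Literature.AnabelianGeometry.EtaleTheta.IsThetaKummer
import Literature.AnabelianGeometry.EtaleTheta.SettingModelTateThetaKummerInput
import Literature.AnabelianGeometry.EtaleTheta.SettingModelTateInstance
import HarnessLib

/-!
# [EtTh] Prop. 1.4 (iii), first sentence — NODE CLOSER for `EtTh:Prop1.4(iii)` with the K4 binder
# `ConstCompat` (FACT-LIST row F-0618, universal closure refuted) RE-KEYED on its surviving instance form

S. Mochizuki, *The étale theta function and its Frobenioid-theoretic manifestations*, Publ. RIMS **45**
(2009) [EtTh], §1, Prop. 1.4 (iii), PRIMS PDF p. 22 (printed p. 248) ll. 16–26 of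
`paper:doi-10-2977-prims-1234361159` [cite: MochizukiEtTh2009, Prop 1.4 (iii) p.22]:

> "(iii) The classes `O^×_K̈ · η̈^Θ ∈ H¹(Π^tp_Ÿ, Δ_Θ)` of Proposition 1.3 are precisely the 'Kummer classes'
> associated to `O^×_K̈`-multiples of `Θ̈`, regarded as a regular function on `Ÿ`."

and Prop. 1.3, PDF p. 21 ll. 4–6: "where `O^×_K̈` acts via the composite of the Kummer map
`O^×_K̈ → H¹(G_K̈, Δ_Θ)` with the natural map `H¹(G_K̈, Δ_Θ) → H¹(Π^tp_Ÿ, Δ_Θ)`".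

PROOF-ONLY companion (theorems only: no `def`, no `Prop` fact, no instance; abc-iut cell, layer L2, cone node
**`EtTh:Prop1.4(iii)`** (typer abc-iut-L2-t1, `ThetaCohomology.lean` p406645); R-C «K4 RE-CLOSE» row of
abc-iut-L2-lead R559′, seat abc-iut-f-128 gen 2).  Nothing landed is edited or restated.

THE K4 SITE (abc-iut-c312-2 `CONE-FACT-SURGERY.tsv` v4): the kernel index node `N_EtTh_Prop1_4_iii` conjoins the
five theorems of `IsThetaKummer.lean` (abc-iut-L2-t12); the fifth,
`thetaClasses_eq_kummerUnitMultiples_of_isThetaKummer`, binds `hT : T.ConstCompat E.toKummerData` — the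
compatibility of abc-iut-L2-t1's ABSTRACT Kummer injection of constants (`kumYdd`, inflated) with the bridge's
Kummer classes of constant functions of the theta-Kummer input `T` — and `ConstCompat` is FACT-LIST row F-0618
whose universal closure is REFUTED in the tree (`ThetaSetting.not_forall_constCompat`, abc-iut-f-117 lineage: a
degenerate `T` with trivial coefficients is compatible with NO Kummer datum; exact reduction
`forall_constCompat_iff_isEmpty_kummerData`).  In print there is ONE Kummer theory on `Ÿ`, so the compatibility is
automatic; in the tree it is a genuine constraint on the PAIR `(T, E)`, TRUE whenever both records come from one
Kummer core (abc-iut-w5-d125, `ThetaSetting.KummerCore.exists_thetaKummerInput_constCompat`, `ThetaKummerInputOfCore`).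

WHAT THIS FILE DOES (w6-d039's «clause coverage / K4» format, 18:19:57Z):
* §1 `ThetaKummerInput.mem_kumUnitsYdd_iff_of_unitsCompat`, `kummerUnitMultiples_eq_of_unitsCompat`,
  **`thetaClasses_eq_kummerUnitMultiples_of_isThetaKummer_of_unitsCompat`** — the fifth conjunct RE-KEYED on the
  print-shaped WEAKER hypothesis «compatibility on `O^×_K̈` only» (print p. 21 only ever applies the Kummer map
  to `O^×_K̈`): a core-relational binder, no longer the F-0618 head; `unitsCompat_of_constCompat` records that
  the typed F-0618 implies it.
* §2 **`KummerCore.prop14iii_node`** — the node IN PRINT'S SHAPE over the SURVIVING INSTANCE FORM of F-0618: for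
  every Kummer core `C` of a theta setting and every `θ ∈ K̈^×` there is a theta-Kummer input `T` ("`Θ̈ := θ`",
  bijective cyclotome identification `Λ(Fn) ≅ Δ_Θ`) with `T.ConstCompat C.toKummerData` as a CONCLUSION, and for
  EVERY étale-theta datum `E` over `C.toKummerData` the five index clauses hold with NO `ConstCompat` binder — the
  node's only remaining hypothesis is its own printed one, `E.IsThetaKummer T` («`η̈^Θ` … the Kummer class»,
  p. 21, abc-iut-L2-lead ruling 2026-08-25 20:58Z).
* §3 AT THE DATA OF RECORD, BY NAME: `SettingModel.prop14iii_node_modelχq` (stage-2 χ-models, all `(i, j)`,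
  `j` even; abc-iut-w5-d171's `kummerCoreχq`), **`prop14iii_node_modelTate`** (the Tate instance
  `ThetaSetting.modelTate p = modelχq p 1 2`), `prop14iii_node_modelχ` (the χ-twisted root model); and the
  NON-VACUITY of the re-keyed node's own binder there: `exists_isThetaKummer_constCompat_modelTate` — a pair
  `(T, E)` over the Tate Kummer datum with `ConstCompat`, `E.IsThetaKummer T`, GENUINE `κΘ̈ ≠ 1`, and the printed
  conclusion (theta classes = Kummer classes of the `O^×_K̈`-multiples of `Θ̈`) — abc-iut-w5-d125's
  `kummerDataχq_exists_prop14iiiKummer_genuine` read through `IsThetaKummer`.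

HONEST FRAMING: bookkeeping over PROVED rows plus one weakening of a hypothesis; refereed pre-IUT material; the
function group of the core-built `T` is the constants-only one of `ThetaKummerInputOfCore` (genuine Kummer THEORY,
degenerate FUNCTION — honest label there); semi-synthetic models = consistency evidence for the typed interface
only; nothing of [EtTh] is asserted unconditionally; typed ≠ proved; instantiated ≠ endorsed; no side is taken on
[IUTchIII] Cor. 3.12.
-/

noncomputable section

namespace Literature.AnabelianGeometry.EtaleTheta

open Literature.AnabelianGeometry.SemiGraphs

namespace ThetaSetting

variable {p : ℕ} [Fact p.Prime] {D : ThetaSetting p}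

/-! ### §1 The K4 binder re-keyed on print's shape: compatibility of the two Kummer maps on `O^×_K̈` only -/

namespace ThetaKummerInput

variable (T : D.ThetaKummerInput)

/-- The typed F-0618 `ConstCompat` (compatibility on all of `K̈^×`) implies compatibility on `O^×_K̈`.
[cite: MochizukiEtTh2009, Prop 1.3 p.21] -/
theorem unitsCompat_of_constCompat {E : D.KummerData} (hT : T.ConstCompat E) :
    ∀ c ∈ D.unitsOKdd, D.inflTheta D.GtpYdd (E.kumYdd (E.toKddHat c)) = T.kummerConst c :=
  fun c _ => hT c

/-- Under compatibility ON `O^×_K̈` of abc-iut-L2-t1's Kummer injection with the bridge's Kummer classes of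
constants, the subgroup `O^×_K̈ ⊆ H¹(Π^tp_Ÿ, Δ_Θ)` (`kumUnitsYdd`: "`O^×_K̈` acts via the composite of the Kummer
map `O^×_K̈ → H¹(G_K̈, Δ_Θ)` with the natural map", p. 21) consists of the bridge's Kummer classes of the units.
[cite: MochizukiEtTh2009, Prop 1.3 p.21] -/
theorem mem_kumUnitsYdd_iff_of_unitsCompat {E : D.KummerData}
    (hT : ∀ c ∈ D.unitsOKdd, D.inflTheta D.GtpYdd (E.kumYdd (E.toKddHat c)) = T.kummerConst c)
    (k : D.H1 D.GtpYdd) : k ∈ E.kumUnitsYdd ↔ ∃ c ∈ D.unitsOKdd, k = T.kummerConst c := by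
  constructor
  · rintro ⟨_, ⟨c, hc, rfl⟩, rfl⟩
    exact ⟨c, hc, hT c hc⟩
  · rintro ⟨c, hc, rfl⟩
    exact ⟨E.toKddHat c, ⟨c, hc, rfl⟩, hT c hc⟩

/-- Hence the Kummer classes of the `O^×_K̈`-multiples `c · Θ̈` are exactly the `O^×_K̈`-translates of `κΘ̈`
(abc-iut-L2-t12's `kummerUnitMultiples_eq` with its hypothesis weakened to `O^×_K̈`).
[cite: MochizukiEtTh2009, Prop 1.4 (iii) p.22] -/
theorem kummerUnitMultiples_eq_of_unitsCompat {E : D.KummerData}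
    (hT : ∀ c ∈ D.unitsOKdd, D.inflTheta D.GtpYdd (E.kumYdd (E.toKddHat c)) = T.kummerConst c) :
    {x | ∃ c ∈ D.unitsOKdd, x = T.kummerConstMulTheta c} =
      {x | ∃ k ∈ E.kumUnitsYdd, x = k * T.kummerTheta} := by
  ext x
  constructor
  · rintro ⟨c, hc, rfl⟩
    exact ⟨T.kummerConst c, (T.mem_kumUnitsYdd_iff_of_unitsCompat hT _).2 ⟨c, hc, rfl⟩,
      T.kummer_const_mul_theta c⟩
  · rintro ⟨k, hk, rfl⟩
    obtain ⟨c, hc, rfl⟩ := (T.mem_kumUnitsYdd_iff_of_unitsCompat hT k).1 hk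
    exact ⟨c, hc, (T.kummer_const_mul_theta c).symm⟩

end ThetaKummerInput

/-- **Prop. 1.4 (iii), first sentence, with the K4 binder re-keyed**: if `η̈^Θ` is an étale theta class of the
Kummer class `κΘ̈` of `Θ̈` (`IsThetaKummer`, the node's own printed hypothesis) and the two Kummer maps of
constants agree ON `O^×_K̈` (print's shape, p. 21 — a core-relational hypothesis replacing the F-0618 head
`ConstCompat`), then the theta classes `O^×_K̈ · η̈^Θ` are exactly the Kummer classes of the `O^×_K̈`-multiples
`c · Θ̈`. [cite: MochizukiEtTh2009, Prop 1.4 (iii) p.22] -/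
theorem thetaClasses_eq_kummerUnitMultiples_of_isThetaKummer_of_unitsCompat {E : D.EtaleThetaData}
    {T : D.ThetaKummerInput} (h : E.IsThetaKummer T)
    (hT : ∀ c ∈ D.unitsOKdd, D.inflTheta D.GtpYdd (E.kumYdd (E.toKddHat c)) = T.kummerConst c) :
    E.thetaClasses = {x | ∃ c ∈ D.unitsOKdd, x = T.kummerConstMulTheta c} := by
  rw [T.kummerUnitMultiples_eq_of_unitsCompat hT]
  exact prop14iii_of_isThetaKummer h

/-! ### §2 The node in print's shape over the surviving instance form of F-0618: one Kummer theory (a Kummer core) -/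

namespace KummerCore

variable (C : D.KummerCore)

/-- **[EtTh] Prop. 1.4 (iii)₁ — NODE CLOSER over a Kummer core.**  For every Kummer core `C` of the theta
setting and every `θ ∈ K̈^×` there is a theta-Kummer input `T` ("`Θ̈ := θ`", abc-iut-w5-d125's core-built input:
bijective `Λ(Fn) ≅ Δ_Θ`, `κΘ̈ = κ(θ)`, `κΘ̈ = 1 ↔ θ = 1`) whose Kummer classes of constants ARE compatible with the
core's Kummer datum — F-0618 `ConstCompat` as a CONCLUSION — and such that for EVERY étale-theta datum `E` over
`C.toKummerData` the five clauses of the kernel index node `N_EtTh_Prop1_4_iii` hold with NO compatibility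
binder: `IsThetaKummer` ⟺ `κΘ̈ ∈ O^×_K̈ · η̈^Θ` ⟺ `O^×_K̈ · η̈^Θ = O^×_K̈ · κΘ̈` ⟺ `Prop14iiiKummer E κΘ̈`, and
`IsThetaKummer` ⟹ «the classes `O^×_K̈ · η̈^Θ` are precisely the Kummer classes associated to `O^×_K̈`-multiples
of `Θ̈`». [cite: MochizukiEtTh2009, Prop 1.4 (iii) p.22] -/
theorem prop14iii_node (θ : (↥D.Kdd)ˣ) :
    ∃ T : D.ThetaKummerInput, Function.Bijective T.coeff.hom ∧ T.ConstCompat C.toKummerData ∧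
      T.kummerTheta = T.kummerConst θ ∧ (T.kummerTheta = 1 ↔ θ = 1) ∧
      ∀ E : D.EtaleThetaData, E.toKummerData = C.toKummerData →
        (E.IsThetaKummer T ↔ T.kummerTheta ∈ E.thetaClasses) ∧
        (E.IsThetaKummer T ↔ E.thetaClasses = {x | ∃ k ∈ E.kumUnitsYdd, x = k * T.kummerTheta}) ∧
        (E.IsThetaKummer T ↔ Prop14iiiKummer E T.kummerTheta) ∧
        (E.IsThetaKummer T → E.thetaClasses = {x | ∃ c ∈ D.unitsOKdd, x = T.kummerConstMulTheta c}) := by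
  obtain ⟨T, hb, hCC, hθ, hiff⟩ := C.exists_thetaKummerInput_constCompat θ
  refine ⟨T, hb, hCC, hθ, hiff, fun E hE => ⟨isThetaKummer_iff_mem E T, isThetaKummer_iff_thetaClasses_eq E T,
    isThetaKummer_iff_prop14iiiKummer E T, fun h => ?_⟩⟩
  have hCC' : T.ConstCompat E.toKummerData := by rw [hE]; exact hCC
  exact thetaClasses_eq_kummerUnitMultiples_of_isThetaKummer h hCC'

end KummerCore

end ThetaSetting

/-! ### §3 At the data of record, BY NAME (abc-iut-w5-d171's Kummer cores of the χ-models; the Tate instance) -/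

namespace SettingModel

open ThetaSetting

/-- **The node closer at every stage-2 χ-model `modelχq p i j` (`j` even), Kummer core `kummerCoreχq`** (the
pull-back action instance `T.instAction` is supplied by `letI` at the concrete carrier, as in
`SettingModelTateThetaKummerInput`). [cite: MochizukiEtTh2009, Prop 1.4 (iii) p.22] -/
theorem prop14iii_node_modelχq (p : ℕ) [Fact p.Prime] (i j : ℤ) (hj : Even j)
    (θ : (↥(ThetaSetting.modelχq p i j hj).Kdd)ˣ) :
    ∃ T : (ThetaSetting.modelχq p i j hj).ThetaKummerInput,
      (letI := T.instAction; Function.Bijective T.coeff.hom) ∧ T.ConstCompat (kummerDataχq p i j hj) ∧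
      T.kummerTheta = T.kummerConst θ ∧ (T.kummerTheta = 1 ↔ θ = 1) ∧
      ∀ E : (ThetaSetting.modelχq p i j hj).EtaleThetaData, E.toKummerData = kummerDataχq p i j hj →
        (E.IsThetaKummer T ↔ T.kummerTheta ∈ E.thetaClasses) ∧
        (E.IsThetaKummer T ↔ E.thetaClasses = {x | ∃ k ∈ E.kumUnitsYdd, x = k * T.kummerTheta}) ∧
        (E.IsThetaKummer T ↔ Prop14iiiKummer E T.kummerTheta) ∧
        (E.IsThetaKummer T → E.thetaClasses =
          {x | ∃ c ∈ (ThetaSetting.modelχq p i j hj).unitsOKdd, x = T.kummerConstMulTheta c}) :=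
  (kummerCoreχq p i j hj).prop14iii_node θ

/-- **The node closer at the Tate instance `ThetaSetting.modelTate p = modelχq p 1 2`**, Kummer datum of record
`kummerDataχq p 1 2`. [cite: MochizukiEtTh2009, Prop 1.4 (iii) p.22] -/
theorem prop14iii_node_modelTate (p : ℕ) [Fact p.Prime] (θ : (↥(ThetaSetting.modelTate p).Kdd)ˣ) :
    ∃ T : (ThetaSetting.modelTate p).ThetaKummerInput,
      (letI := T.instAction; Function.Bijective T.coeff.hom) ∧ T.ConstCompat (kummerDataχq p 1 2 even_two) ∧
      T.kummerTheta = T.kummerConst θ ∧ (T.kummerTheta = 1 ↔ θ = 1) ∧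
      ∀ E : (ThetaSetting.modelTate p).EtaleThetaData, E.toKummerData = kummerDataχq p 1 2 even_two →
        (E.IsThetaKummer T ↔ T.kummerTheta ∈ E.thetaClasses) ∧
        (E.IsThetaKummer T ↔ E.thetaClasses = {x | ∃ k ∈ E.kumUnitsYdd, x = k * T.kummerTheta}) ∧
        (E.IsThetaKummer T ↔ Prop14iiiKummer E T.kummerTheta) ∧
        (E.IsThetaKummer T → E.thetaClasses =
          {x | ∃ c ∈ (ThetaSetting.modelTate p).unitsOKdd, x = T.kummerConstMulTheta c}) :=
  prop14iii_node_modelχq p 1 2 even_two θ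

/-- **The node closer at the χ-twisted root model `modelχ p`**, Kummer core `kummerCoreχ p` (abc-iut-w5-d171).
[cite: MochizukiEtTh2009, Prop 1.4 (iii) p.22] -/
theorem prop14iii_node_modelχ (p : ℕ) [Fact p.Prime] (θ : (↥(ThetaSetting.modelχ p).Kdd)ˣ) :
    ∃ T : (ThetaSetting.modelχ p).ThetaKummerInput,
      (letI := T.instAction; Function.Bijective T.coeff.hom) ∧ T.ConstCompat (kummerDataχ p) ∧
      T.kummerTheta = T.kummerConst θ ∧ (T.kummerTheta = 1 ↔ θ = 1) ∧
      ∀ E : (ThetaSetting.modelχ p).EtaleThetaData, E.toKummerData = kummerDataχ p →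
        (E.IsThetaKummer T ↔ T.kummerTheta ∈ E.thetaClasses) ∧
        (E.IsThetaKummer T ↔ E.thetaClasses = {x | ∃ k ∈ E.kumUnitsYdd, x = k * T.kummerTheta}) ∧
        (E.IsThetaKummer T ↔ Prop14iiiKummer E T.kummerTheta) ∧
        (E.IsThetaKummer T → E.thetaClasses =
          {x | ∃ c ∈ (ThetaSetting.modelχ p).unitsOKdd, x = T.kummerConstMulTheta c}) :=
  (kummerCoreχ p).prop14iii_node θ

/-- **NON-VACUITY of the re-keyed node at the Tate instance, with a GENUINE Kummer class**: over the Kummer datum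
of record `kummerDataχq p 1 2` there are a theta-Kummer input `T` and an étale-theta datum `E` with `ConstCompat`,
the node's own binder `E.IsThetaKummer T`, `κΘ̈ ≠ 1`, and the printed conclusion «`O^×_K̈ · η̈^Θ` = the Kummer
classes of the `O^×_K̈`-multiples of `Θ̈`» (abc-iut-w5-d125's `kummerDataχq_exists_prop14iiiKummer_genuine`, read
through `IsThetaKummer` with `η̈^Θ = κΘ̈`). [cite: MochizukiEtTh2009, Prop 1.4 (iii) p.22] -/
theorem exists_isThetaKummer_constCompat_modelTate (p : ℕ) [Fact p.Prime] :
    ∃ (T : (ThetaSetting.modelTate p).ThetaKummerInput) (E : (ThetaSetting.modelTate p).EtaleThetaData),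
      E.toKummerData = kummerDataχq p 1 2 even_two ∧ T.ConstCompat E.toKummerData ∧ E.IsThetaKummer T ∧
      T.kummerTheta ≠ 1 ∧
      E.thetaClasses = {x | ∃ c ∈ (ThetaSetting.modelTate p).unitsOKdd, x = T.kummerConstMulTheta c} := by
  obtain ⟨T, E, -, hE, hCC, hη, hne, -, hcl⟩ := kummerDataχq_exists_prop14iiiKummer_genuine p 1 2 even_two
  exact ⟨T, E, hE, hE ▸ hCC, ⟨1, one_mem _, by rw [one_mul]; exact hη⟩, hne, hcl⟩

end SettingModel

end Literature.AnabelianGeometry.EtaleTheta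

end
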